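import Summits.Ventures.Crystal3D.TopCut.X2SOSSound
import Summits.Ventures.Crystal3D.Bulk.CapX2Dense
import HarnessLib

/-!
# X2 cap certificates by sum-of-squares identities, IV: inequality (I) against a LITERAL singles polynomial

Venture `Crystal3D` (cell `pub-crystal3d`, phase 2; seat p2). Seat p1's kernel check of inequality (I)
(`Bulk/CapX2CheckI.lean`: `checkIneqIX2 c M pts` = a Taylor-box cover of `M - Dtot` with the singles
polynomial `dtotPoly c` RECOMPUTED inside the cover) exceeds the kernel memory of standard farm nodes
for the larger certificates ((d, d_X) = (10, 10)). This file splits the check in two `decide`s: the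
certificate's singles polynomial is compared ONCE with a literal coefficient list `dI`
(`CapX2.eqv1`, trailing-zero-insensitive), and p3's Taylor-box cover (`CapCut.checkCover`) runs on the
literal. `ineqI_of_cover` glues them to `c.IneqI M`. Standard axioms only.
HONEST FRAMING: a two-line soundness lemma [folklore]; NO certificate is asserted here.
-/

noncomputable section

open Literature.Geometry.DiscreteGeometry Literature.Geometry.DiscreteGeometry.BachocVallentin
open Summit.Ventures.Crystal3D.CapCut Summit.Ventures.Crystal3D.CapX2

namespace Summit.Ventures.Crystal3D.X2SOS

/-- The cover check of (I) on a literal coefficient list `dI` standing for `Dtot`: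
`M - dI ≥ 0` on `[u₀, 1]` by p3's chained Taylor-form box test over the break points `pts`. [folklore] -/
def coverI (c : X2Cert) (dI : List ℚ) (M : ℚ) (pts : List ℚ) : Bool :=
  checkCover (padd [M] (pscale (-1) dI)) c.u0 pts 1

/-- **(I) from a literal singles polynomial**: if `dtotPoly c` agrees with `dI` up to trailing zeros
(one `decide`) and the cover check passes on `dI` (a second `decide`), then `c.IneqI M`. [folklore] -/
theorem ineqI_of_cover (c : X2Cert) (dI : List ℚ) (M : ℚ) (pts : List ℚ)
    (h1 : eqv1 (dtotPoly c) dI = true) (h2 : coverI c dI M pts = true) : c.IneqI M := by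
  intro u hu0 hu1
  have h0 := nonneg_of_checkCover _ pts c.u0 1 h2 u hu0 (by exact_mod_cast hu1)
  rw [eval_padd, eval_pscale, ← eval_congr_of_eqv1 _ _ h1 u, eval_dtotPoly] at h0
  simp [upolyEval] at h0
  linarith

end Summit.Ventures.Crystal3D.X2SOS

end
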